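import Literature.Geometry.Riemannian.DehnFillingCusps
import Literature.Topology.FourManifolds.DehnSurgeryTubularNbhdProofs
import Literature.Geometry.Manifold.OpenSubmanifoldMFDeriv
import Mathlib.Geometry.Manifold.ContMDiffMFDeriv
import HarnessLib

/-!
# The angle parametrisation of the filling piece `T² × D̊²`

Support file (everything proved; no named fact, no `sorry`) for the Gromov–Thurston `2π` theorem
`Literature.Geometry.Riemannian.gromovThurston_twoPi_four` (`CuspedHyperbolic.lean`). The
filling piece `fillingPiece = (𝕊¹ × 𝕊¹) × D̊²` of a Dehn filling (`IsDehnFilling`,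
Anderson 2006, §2.1, (2.2)) is parametrised by the angle-disc coordinates
`(θ₁, θ₂, w₁, w₂) ∈ ℝ⁴`:

* `pieceParam q = ((e^{iθ₁}, e^{iθ₂}), (w₁, w₂))` — smooth (`contMDiff_pieceParam`),
  `2π`-periodic in the angles (`pieceParam_add_shift`, `exists_shift_of_pieceParam_eq`);
* `pieceLift` — a right inverse of `pieceParam`, smooth near a given point (built from the smooth
  local angle functions `angA`, `angB` of `TorusCoordinates.lean`; smoothness of `circlePoint` and
  its fibres are taken from `DehnSurgeryTubularNbhdProofs.lean`); hence the differential of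
  `pieceParam` is onto and, the dimensions being `4 = 4`, **injective**
  (`injective_mfderiv_pieceParam`) — `pieceParam` is a local diffeomorphism (the universal
  covering of `T² × ℝ²`);
* `pieceChart V hV : V → fillingPiece` — its restriction to an open set of `ℝ⁴` with
  `w₁² + w₂² < 1`, smooth with injective differential (`contMDiff_pieceChart`,
  `injective_mfderiv_pieceChart`).

## References

* M. T. Anderson, *Dehn filling and Einstein metrics in higher dimensions*, J. Differential Geom.
  73 (2006) 219–261, §2.1. [Anderson2006]
* M. W. Hirsch, *Differential Topology* (1976), Ch. 1 §1 (the circle as a quotient of the line).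
  [HirschDT1976]
-/

noncomputable section

open Set Function Filter TopologicalSpace Bundle
open scoped Manifold ContDiff Topology

namespace Literature.Geometry.Riemannian

open Literature.Topology.FourManifolds Literature.Geometry.Manifold

/-- Local notation: `𝔼 n` is the model Euclidean space `EuclideanSpace ℝ (Fin n)`. -/
local notation "𝔼 " n:arg => EuclideanSpace ℝ (Fin n)

/-- Local notation: `𝕊 n` is the unit sphere in `EuclideanSpace ℝ (Fin (n + 1))`. -/
local notation "𝕊 " n:arg => (Metric.sphere (0 : EuclideanSpace ℝ (Fin (n + 1))) 1)

set_option quotPrecheck false in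
/-- Local notation: the model with corners of the filling piece `(𝕊¹ × 𝕊¹) × ℝ²`. -/
local notation "𝓜" =>
  (ModelWithCorners.prod (ModelWithCorners.prod (𝓡 1) (𝓡 1)) 𝓘(ℝ, EuclideanSpace ℝ (Fin 2)))

/-! ### The parametrisation -/

/-- **The angle parametrisation** `(θ₁, θ₂, w₁, w₂) ↦ ((e^{iθ₁}, e^{iθ₂}), (w₁, w₂))` of
`(𝕊¹ × 𝕊¹) × ℝ² ⊇ T² × D̊²` (Anderson 2006, §2.1: the meridian circle and the core torus of the
generalised solid torus `D² × T²`). [cite: Anderson2006, §2.1, (2.2)] -/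
def pieceParam (q : 𝔼 4) : ((𝕊 1) × (𝕊 1)) × (𝔼 2) :=
  ((circlePoint (q 0), circlePoint (q 1)), mk2 (q 2) (q 3))

/-- The disc coordinate of `pieceParam`. [folklore] -/
@[simp] theorem pieceParam_snd (q : 𝔼 4) : (pieceParam q).2 = mk2 (q 2) (q 3) := rfl

/-- The first circle coordinate of `pieceParam`. [folklore] -/
@[simp] theorem pieceParam_fst_fst (q : 𝔼 4) : (pieceParam q).1.1 = circlePoint (q 0) := rfl

/-- The second circle coordinate of `pieceParam`. [folklore] -/
@[simp] theorem pieceParam_fst_snd (q : 𝔼 4) : (pieceParam q).1.2 = circlePoint (q 1) := rfl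

/-- `q ↦ (q₂, q₃)` is smooth. [folklore] -/
theorem contDiff_mk2_comp : ContDiff ℝ ∞ fun q : 𝔼 4 ↦ mk2 (q 2) (q 3) := by
  rw [contDiff_euclidean]
  intro i
  fin_cases i
  · exact (EuclideanSpace.proj (2 : Fin 4) : 𝔼 4 →L[ℝ] ℝ).contDiff
  · exact (EuclideanSpace.proj (3 : Fin 4) : 𝔼 4 →L[ℝ] ℝ).contDiff

/-- **`pieceParam` is smooth.** [folklore] -/
theorem contMDiff_pieceParam : ContMDiff 𝓘(ℝ, 𝔼 4) 𝓜 ∞ pieceParam :=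
  ((contMDiff_circlePoint.comp (EuclideanSpace.proj (0 : Fin 4) : 𝔼 4 →L[ℝ] ℝ).contMDiff).prodMk
    (contMDiff_circlePoint.comp (EuclideanSpace.proj (1 : Fin 4) : 𝔼 4 →L[ℝ] ℝ).contMDiff)).prodMk
    contDiff_mk2_comp.contMDiff

/-- The angle shift `(c₀, c₁, 0, 0)`. [folklore] -/
def shift (c₀ c₁ : ℝ) : 𝔼 4 := WithLp.toLp 2 ![c₀, c₁, 0, 0]

/-- Coordinate `0` of the shift. [folklore] -/
@[simp] theorem shift_apply_zero (c₀ c₁ : ℝ) : shift c₀ c₁ 0 = c₀ := rfl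
/-- Coordinate `1` of the shift. [folklore] -/
@[simp] theorem shift_apply_one (c₀ c₁ : ℝ) : shift c₀ c₁ 1 = c₁ := rfl
/-- Coordinate `2` of the shift. [folklore] -/
@[simp] theorem shift_apply_two (c₀ c₁ : ℝ) : shift c₀ c₁ 2 = 0 := rfl
/-- Coordinate `3` of the shift. [folklore] -/
@[simp] theorem shift_apply_three (c₀ c₁ : ℝ) : shift c₀ c₁ 3 = 0 := rfl

/-- **Periodicity**: `pieceParam` is invariant under integer multiples of `2π` in the angles.
[folklore] -/
theorem pieceParam_add_shift (q : 𝔼 4) (k₀ k₁ : ℤ) :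
    pieceParam (q + shift (k₀ * (2 * Real.pi)) (k₁ * (2 * Real.pi))) = pieceParam q := by
  simp only [pieceParam, PiLp.add_apply, shift_apply_zero, shift_apply_one, shift_apply_two,
    shift_apply_three, add_zero]
  rw [periodic_circlePoint.int_mul k₀ (q 0), periodic_circlePoint.int_mul k₁ (q 1)]

/-- `mk2` is injective. [folklore] -/
theorem mk2_injective {a b a' b' : ℝ} (h : mk2 a b = mk2 a' b') : a = a' ∧ b = b' :=
  ⟨by simpa using congrArg (fun v : 𝔼 2 ↦ v 0) h, by simpa using congrArg (fun v : 𝔼 2 ↦ v 1) h⟩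

/-- **Fibres of `pieceParam`**: two parameter points with the same image differ by a shift of
the angles by multiples of `2π`. [folklore] -/
theorem exists_shift_of_pieceParam_eq {q q' : 𝔼 4} (h : pieceParam q' = pieceParam q) :
    ∃ k₀ k₁ : ℤ, q' = q + shift (k₀ * (2 * Real.pi)) (k₁ * (2 * Real.pi)) := by
  have h0 : circlePoint (q' 0) = circlePoint (q 0) := congrArg (fun y ↦ y.1.1) h
  have h1 : circlePoint (q' 1) = circlePoint (q 1) := congrArg (fun y ↦ y.1.2) h
  have h23 := mk2_injective (congrArg (fun y ↦ y.2) h)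
  obtain ⟨k₀, hk₀⟩ := exists_eq_add_of_circlePoint_eq h0
  obtain ⟨k₁, hk₁⟩ := exists_eq_add_of_circlePoint_eq h1
  refine ⟨k₀, k₁, ?_⟩
  ext i
  fin_cases i
  · simpa using hk₀
  · simpa using hk₁
  · simpa using h23.1
  · simpa using h23.2

/-! ### A local right inverse -/

open Classical in
/-- A lift of the circle to angles, smooth near the given point `u₀`: `2π angA` if `u₀ ≠ ptA`,
else `2π angB` (`TorusCoordinates.lean`). [folklore] -/
def angLift (u₀ : 𝕊 1) (u : 𝕊 1) : ℝ :=
  if u₀ ≠ ptA then 2 * Real.pi * angA u else 2 * Real.pi * angB u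

/-- `angLift u₀` is a right inverse of `circlePoint`. [folklore] -/
theorem circlePoint_angLift (u₀ u : 𝕊 1) : circlePoint (angLift u₀ u) = u := by
  unfold angLift
  split_ifs
  · exact circlePt_angA u
  · exact circlePt_angB u

/-- `angLift u₀` is smooth at `u₀`. [folklore] -/
theorem contMDiffAt_angLift (u₀ : 𝕊 1) : ContMDiffAt (𝓡 1) 𝓘(ℝ, ℝ) ∞ (angLift u₀) u₀ := by
  unfold angLift
  split_ifs with h
  · exact (contDiff_const.mul contDiff_id).contDiffAt.comp_contMDiffAt (contMDiffAt_angA h)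
  · rw [not_not] at h
    have hB : u₀ ≠ ptB := h ▸ ptA_ne_ptB
    exact (contDiff_const.mul contDiff_id).contDiffAt.comp_contMDiffAt (contMDiffAt_angB hB)

/-- **A right inverse of `pieceParam`**, smooth near `pieceParam q₀`:
`((u, v), w) ↦ (angLift u, angLift v, w₁, w₂)`. [folklore] -/
def pieceLift (q₀ : 𝔼 4) (y : ((𝕊 1) × (𝕊 1)) × (𝔼 2)) : 𝔼 4 :=
  WithLp.toLp 2 ![angLift (circlePoint (q₀ 0)) y.1.1, angLift (circlePoint (q₀ 1)) y.1.2,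
    y.2 0, y.2 1]

/-- `pieceParam ∘ pieceLift q₀ = id`. [folklore] -/
theorem pieceParam_pieceLift (q₀ : 𝔼 4) (y : ((𝕊 1) × (𝕊 1)) × (𝔼 2)) :
    pieceParam (pieceLift q₀ y) = y := by
  obtain ⟨⟨u, v⟩, w⟩ := y
  simp only [pieceParam, pieceLift]
  refine Prod.ext (Prod.ext ?_ ?_) ?_
  · exact circlePoint_angLift _ u
  · exact circlePoint_angLift _ v
  · ext i
    fin_cases i <;> rfl

/-- `pieceLift q₀` is smooth at `pieceParam q₀`. [folklore] -/
theorem contMDiffAt_pieceLift (q₀ : 𝔼 4) :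
    ContMDiffAt 𝓜 𝓘(ℝ, 𝔼 4) ∞ (pieceLift q₀) (pieceParam q₀) := by
  -- the four coordinate functions are smooth at the point
  have h0 : ContMDiffAt 𝓜 𝓘(ℝ, ℝ) ∞ (fun y : ((𝕊 1) × (𝕊 1)) × (𝔼 2) ↦
      angLift (circlePoint (q₀ 0)) y.1.1) (pieceParam q₀) :=
    (contMDiffAt_angLift _).comp (pieceParam q₀) (contMDiffAt_fst.comp _ contMDiffAt_fst)
  have h1 : ContMDiffAt 𝓜 𝓘(ℝ, ℝ) ∞ (fun y : ((𝕊 1) × (𝕊 1)) × (𝔼 2) ↦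
      angLift (circlePoint (q₀ 1)) y.1.2) (pieceParam q₀) :=
    (contMDiffAt_angLift _).comp (pieceParam q₀) (contMDiffAt_snd.comp _ contMDiffAt_fst)
  have h2 : ContMDiffAt 𝓜 𝓘(ℝ, ℝ) ∞ (fun y : ((𝕊 1) × (𝕊 1)) × (𝔼 2) ↦ y.2 0) (pieceParam q₀) :=
    ((EuclideanSpace.proj (0 : Fin 2) : 𝔼 2 →L[ℝ] ℝ).contMDiff.contMDiffAt).comp _ contMDiffAt_snd
  have h3 : ContMDiffAt 𝓜 𝓘(ℝ, ℝ) ∞ (fun y : ((𝕊 1) × (𝕊 1)) × (𝔼 2) ↦ y.2 1) (pieceParam q₀) :=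
    ((EuclideanSpace.proj (1 : Fin 2) : 𝔼 2 →L[ℝ] ℝ).contMDiff.contMDiffAt).comp _ contMDiffAt_snd
  -- assemble through the smooth linear map `ℝ⁴ → 𝔼 4`
  have hL : ContMDiffAt 𝓜 𝓘(ℝ, ℝ × ℝ × ℝ × ℝ) ∞ (fun y : ((𝕊 1) × (𝕊 1)) × (𝔼 2) ↦
      (angLift (circlePoint (q₀ 0)) y.1.1, angLift (circlePoint (q₀ 1)) y.1.2, y.2 0, y.2 1))
      (pieceParam q₀) :=
    h0.prodMk_space (h1.prodMk_space (h2.prodMk_space h3))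
  set T : ℝ × ℝ × ℝ × ℝ → 𝔼 4 := fun p ↦ WithLp.toLp 2 ![p.1, p.2.1, p.2.2.1, p.2.2.2] with hT
  have hTc : ContDiff ℝ ∞ T := by
    rw [contDiff_euclidean]
    intro i
    fin_cases i
    · exact contDiff_fst
    · exact contDiff_fst.comp contDiff_snd
    · exact contDiff_fst.comp (contDiff_snd.comp contDiff_snd)
    · exact contDiff_snd.comp (contDiff_snd.comp contDiff_snd)
  have heq : pieceLift q₀ = T ∘ fun y : ((𝕊 1) × (𝕊 1)) × (𝔼 2) ↦
      (angLift (circlePoint (q₀ 0)) y.1.1, angLift (circlePoint (q₀ 1)) y.1.2, y.2 0, y.2 1) := by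
    funext y
    rfl
  rw [heq]
  exact hTc.contMDiff.contMDiffAt.comp _ hL

/-! ### The differential of `pieceParam` is invertible -/

/-- The model space of the filling piece has dimension `4`. [folklore] -/
theorem finrank_pieceModel : Module.finrank ℝ (((𝔼 1) × (𝔼 1)) × (𝔼 2)) = 4 := by
  simp [Module.finrank_prod]

/-- Translations of `𝔼 4` have identity differential. [folklore] -/
theorem mfderiv_add_const (s q : 𝔼 4) :
    mfderiv 𝓘(ℝ, 𝔼 4) 𝓘(ℝ, 𝔼 4) (fun x : 𝔼 4 ↦ x + s) q = ContinuousLinearMap.id ℝ (𝔼 4) := by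
  rw [mfderiv_eq_fderiv, fderiv_add_const, fderiv_fun_id]

/-- **The differential of `pieceParam` is periodic** under the angle shifts. [folklore] -/
theorem mfderiv_pieceParam_add_shift (q : 𝔼 4) (k₀ k₁ : ℤ) :
    mfderiv 𝓘(ℝ, 𝔼 4) 𝓜 pieceParam (q + shift (k₀ * (2 * Real.pi)) (k₁ * (2 * Real.pi))) =
      mfderiv 𝓘(ℝ, 𝔼 4) 𝓜 pieceParam q := by
  set s := shift (k₀ * (2 * Real.pi)) (k₁ * (2 * Real.pi)) with hs
  have hper : (pieceParam ∘ fun x : 𝔼 4 ↦ x + s) = pieceParam :=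
    funext fun x ↦ pieceParam_add_shift x k₀ k₁
  have hP : MDifferentiableAt 𝓘(ℝ, 𝔼 4) 𝓜 pieceParam (q + s) :=
    contMDiff_pieceParam.mdifferentiableAt (by simp)
  have htr : MDifferentiableAt 𝓘(ℝ, 𝔼 4) 𝓘(ℝ, 𝔼 4) (fun x : 𝔼 4 ↦ x + s) q :=
    ((contDiff_id.add contDiff_const : ContDiff ℝ ∞ fun x : 𝔼 4 ↦ x + s).contMDiff).mdifferentiableAt
      (by simp)
  have h := mfderiv_comp q hP htr
  rw [hper, mfderiv_add_const] at h
  rw [h]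
  exact (ContinuousLinearMap.comp_id _).symm

/-- The differential of `pieceParam` is onto at a point fixed by a section smooth there.
[folklore] -/
theorem surjective_mfderiv_pieceParam_of_section {σ : ((𝕊 1) × (𝕊 1)) × (𝔼 2) → 𝔼 4}
    {y : ((𝕊 1) × (𝕊 1)) × (𝔼 2)} {q : 𝔼 4} (hy : pieceParam q = y)
    (hσ : ContMDiffAt 𝓜 𝓘(ℝ, 𝔼 4) ∞ σ y) (hid : ∀ y, pieceParam (σ y) = y) (hq : σ y = q) :
    Surjective (mfderiv 𝓘(ℝ, 𝔼 4) 𝓜 pieceParam q) := by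
  subst hy
  have hP : MDifferentiableAt 𝓘(ℝ, 𝔼 4) 𝓜 pieceParam q :=
    contMDiff_pieceParam.mdifferentiableAt (by simp)
  have hσd : MDifferentiableAt 𝓜 𝓘(ℝ, 𝔼 4) σ (pieceParam q) := hσ.mdifferentiableAt (by simp)
  have hP' : HasMFDerivAt 𝓘(ℝ, 𝔼 4) 𝓜 pieceParam (σ (pieceParam q))
      (mfderiv 𝓘(ℝ, 𝔼 4) 𝓜 pieceParam q) := by
    rw [hq]; exact hP.hasMFDerivAt
  have h1 : HasMFDerivAt 𝓜 𝓜 (pieceParam ∘ σ) (pieceParam q)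
      ((mfderiv 𝓘(ℝ, 𝔼 4) 𝓜 pieceParam q).comp (mfderiv 𝓜 𝓘(ℝ, 𝔼 4) σ (pieceParam q))) :=
    hP'.comp (pieceParam q) hσd.hasMFDerivAt
  have h2 : HasMFDerivAt 𝓜 𝓜 (id : ((𝕊 1) × (𝕊 1)) × (𝔼 2) → ((𝕊 1) × (𝕊 1)) × (𝔼 2))
      (pieceParam q)
      ((mfderiv 𝓘(ℝ, 𝔼 4) 𝓜 pieceParam q).comp (mfderiv 𝓜 𝓘(ℝ, 𝔼 4) σ (pieceParam q))) :=
    h1.congr_of_eventuallyEq (Eventually.of_forall fun z ↦ (hid z).symm)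
  have hcomp : (mfderiv 𝓘(ℝ, 𝔼 4) 𝓜 pieceParam q).comp (mfderiv 𝓜 𝓘(ℝ, 𝔼 4) σ (pieceParam q)) =
      ContinuousLinearMap.id ℝ _ := by
    rw [← h2.mfderiv, mfderiv_id]
  intro v
  exact ⟨mfderiv 𝓜 𝓘(ℝ, 𝔼 4) σ (pieceParam q) v, ContinuousLinearMap.ext_iff.1 hcomp v⟩

/-- **The differential of `pieceParam` is onto** at every point: `pieceParam ∘ pieceLift = id`
with `pieceLift` smooth at the image point, and periodicity to move the base point. [folklore] -/
theorem surjective_mfderiv_pieceParam (q₀ : 𝔼 4) :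
    Surjective (mfderiv 𝓘(ℝ, 𝔼 4) 𝓜 pieceParam q₀) := by
  have hq₁y : pieceParam (pieceLift q₀ (pieceParam q₀)) = pieceParam q₀ := pieceParam_pieceLift q₀ _
  -- surjectivity at `q₁ = pieceLift q₀ (pieceParam q₀)`
  have hsurj₁ : Surjective (mfderiv 𝓘(ℝ, 𝔼 4) 𝓜 pieceParam (pieceLift q₀ (pieceParam q₀))) :=
    surjective_mfderiv_pieceParam_of_section hq₁y (contMDiffAt_pieceLift q₀)
      (pieceParam_pieceLift q₀) rfl
  -- move the base point by periodicity
  obtain ⟨k₀, k₁, hk⟩ := exists_shift_of_pieceParam_eq hq₁y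
  rw [← mfderiv_pieceParam_add_shift q₀ k₀ k₁, ← hk]
  exact hsurj₁

/-- **The differential of `pieceParam` is injective** (onto between `4`-dimensional spaces):
`pieceParam` is a local diffeomorphism `ℝ⁴ → (𝕊¹ × 𝕊¹) × ℝ²`. [folklore] -/
theorem injective_mfderiv_pieceParam (q₀ : 𝔼 4) :
    Injective (mfderiv 𝓘(ℝ, 𝔼 4) 𝓜 pieceParam q₀) := by
  haveI : FiniteDimensional ℝ (TangentSpace 𝓘(ℝ, 𝔼 4) q₀) :=
    inferInstanceAs (FiniteDimensional ℝ (𝔼 4))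
  haveI : FiniteDimensional ℝ (TangentSpace 𝓜 (pieceParam q₀)) :=
    inferInstanceAs (FiniteDimensional ℝ (((𝔼 1) × (𝔼 1)) × (𝔼 2)))
  have hdim : Module.finrank ℝ (TangentSpace 𝓘(ℝ, 𝔼 4) q₀) =
      Module.finrank ℝ (TangentSpace 𝓜 (pieceParam q₀)) := by
    change Module.finrank ℝ (𝔼 4) = Module.finrank ℝ (((𝔼 1) × (𝔼 1)) × (𝔼 2))
    rw [finrank_pieceModel, finrank_euclideanSpace_fin]
  exact (LinearMap.injective_iff_surjective_of_finrank_eq_finrank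
    (f := (mfderiv 𝓘(ℝ, 𝔼 4) 𝓜 pieceParam q₀).toLinearMap) hdim).2
    (surjective_mfderiv_pieceParam q₀)

/-! ### The chart of the filling piece -/

/-- `‖(q₂, q₃)‖ < 1` iff `q₂² + q₃² < 1`. [folklore] -/
theorem norm_mk2_lt_one_iff (a b : ℝ) : ‖mk2 a b‖ < 1 ↔ a ^ 2 + b ^ 2 < 1 := by
  rw [← norm_mk2_sq, ← pow_lt_one_iff_of_nonneg (norm_nonneg _) two_ne_zero]

/-- **The chart of the filling piece** on an open set `V` of parameters with `w₁² + w₂² < 1`: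
`q ↦ pieceParam q ∈ fillingPiece`. [cite: Anderson2006, §2.1, (2.2)] -/
def pieceChart (V : Opens (𝔼 4)) (hV : ∀ q ∈ V, (q 2) ^ 2 + (q 3) ^ 2 < 1) (q : V) : fillingPiece :=
  ⟨pieceParam q.1, by
    rw [mem_fillingPiece_iff, pieceParam_snd, norm_mk2_lt_one_iff]
    exact hV q.1 q.2⟩

variable {V : Opens (𝔼 4)} {hV : ∀ q ∈ V, (q 2) ^ 2 + (q 3) ^ 2 < 1}

/-- The value of the chart. [folklore] -/
@[simp] theorem coe_pieceChart (q : V) :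
    ((pieceChart V hV q : fillingPiece) : ((𝕊 1) × (𝕊 1)) × (𝔼 2)) = pieceParam q.1 := rfl

/-- **The chart is smooth.** [folklore] -/
theorem contMDiff_pieceChart : ContMDiff 𝓘(ℝ, 𝔼 4) 𝓜 ∞ (pieceChart V hV) :=
  (ContMDiff.subtypeVal_comp_iff fillingPiece (pieceChart V hV)).1
    (contMDiff_pieceParam.comp contMDiff_subtype_val)

/-- **Differentials of maps between open submanifolds**: if `f : U → V` lifts `F : M → M'`
(`(f x).1 = F x.1`) then `df_x = dF_{x.1}` (the inclusions have identity differentials,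
`OpenSubmanifold.mfderiv_subtype_val`). [folklore] -/
theorem mfderiv_eq_of_coe_comp {E' : Type*} [NormedAddCommGroup E'] [NormedSpace ℝ E']
    {H' : Type*} [TopologicalSpace H'] {I' : ModelWithCorners ℝ E' H'}
    {M' : Type*} [TopologicalSpace M'] [ChartedSpace H' M']
    {E'' : Type*} [NormedAddCommGroup E''] [NormedSpace ℝ E'']
    {H'' : Type*} [TopologicalSpace H''] {I'' : ModelWithCorners ℝ E'' H''}
    {M'' : Type*} [TopologicalSpace M''] [ChartedSpace H'' M'']
    {U : Opens M'} {V : Opens M''} (F : M' → M'') (f : U → V) (hfF : ∀ x, ((f x : V) : M'') = F x)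
    (x : U) (hf : MDifferentiableAt I' I'' f x) (hF : MDifferentiableAt I' I'' F x) :
    mfderiv I' I'' f x = mfderiv I' I'' F x := by
  have h1 := mfderiv_comp x (OpenSubmanifold.mdifferentiableAt_subtype_val (f x)) hf
  rw [OpenSubmanifold.mfderiv_subtype_val] at h1
  have h2 := mfderiv_comp x hF (OpenSubmanifold.mdifferentiableAt_subtype_val x)
  rw [OpenSubmanifold.mfderiv_subtype_val] at h2
  have heq : (Subtype.val ∘ f : U → M'') = F ∘ Subtype.val := funext hfF
  rw [heq, h2] at h1
  -- `h1 : (dF).comp id = id.comp (df)`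
  have h3 : mfderiv I' I'' f x = (ContinuousLinearMap.id ℝ E'').comp (mfderiv I' I'' f x) :=
    (ContinuousLinearMap.id_comp _).symm
  have h4 : (mfderiv I' I'' F x).comp (ContinuousLinearMap.id ℝ E') = mfderiv I' I'' F x :=
    ContinuousLinearMap.comp_id _
  exact h3.trans (h1.symm.trans h4)

/-- **The differential of the chart is that of `pieceParam`** (open submanifolds have the
tangent spaces of the ambient manifolds). [folklore] -/
theorem mfderiv_pieceChart (q : V) :
    mfderiv 𝓘(ℝ, 𝔼 4) 𝓜 (pieceChart V hV) q = mfderiv 𝓘(ℝ, 𝔼 4) 𝓜 pieceParam q.1 :=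
  mfderiv_eq_of_coe_comp pieceParam (pieceChart V hV) (fun _ ↦ rfl) q
    (contMDiff_pieceChart.mdifferentiableAt (by simp))
    (contMDiff_pieceParam.mdifferentiableAt (by simp))

/-- **The differential of the chart is injective.** [folklore] -/
theorem injective_mfderiv_pieceChart (q : V) :
    Injective (mfderiv 𝓘(ℝ, 𝔼 4) 𝓜 (pieceChart V hV) q) := by
  rw [mfderiv_pieceChart]
  exact injective_mfderiv_pieceParam q.1

end Literature.Geometry.Riemannian
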